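import Summits.Ventures.PercRepro.C041TriDomOneMarkEdge
import Summits.Ventures.PercRepro.C041TriDomGlueSiblingS

/-!
# ROW C-041 — THE ANCHORED CONJECTURE, part I: the functionals, the certificate's key inequalities, and the patterns
of the contraction of an edge at the double-component of `z` (p6, gen 48; P6-TWOEXIT-LEAN.md §53 ADDENDUM 22 cont. 3)

The anchored functional `AncF` (`+1` on `(⊤,⊥)`, `−1` on `(s₁,s₂)`, `(s₂,s₃)`, `(s₁,s₃)`), the sharing functional
with anchor `z` in the coordinates of `(x, y, z)` (`S1zF`), the four-mark patterns `(xy, xz, xq, yz, yq, zq)` of the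
marks and the other end `q` of the split edge with their projection `proj3` and their `z`–`q` join `zmerge3`, the
certificate's up-sets `Wa = {x ~_R y ∨ x ~_R z ∨ x ~_R q}` and `Wd = {x ~_R y ∨ x ~_R z}`, and the two key inequalities
(`anc_key_P`, `anc_key_VB`: `decide`s over the fifteen partitions `valid6`).  THE GEOMETRY: for a free edge `f = pq`
with `p` in the double-component of `z`, the contraction joins the blocks of `z` and `q` (`RdS_double_iff_zq`,
`MgS_double_iff_zq`), so the three-mark patterns of the contraction are the `z`–`q` joins of the deletion's four-mark
patterns (`rsig_double_zmerge`, `bsig_double_zmerge`).  The theorem is in `C041TriDomAnchoredDomination`.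
-/

namespace PercRepro

namespace ZoneZ

namespace MultiExit

open ZoneData Finset

variable {V₁ E₁ U₁ U₂ : Type} (Z₁ : ZoneData V₁ E₁ U₁ U₂) (u u' a₁ : V₁)

/-! ## The functionals and the certificate's key inequalities -/

/-- The functional of the anchored conjecture in the coordinates `(x ~ y, x ~ z, y ~ z)`: `+1` on `(⊤,⊥)`, `−1` on
the anchored crossed classes `(s₁,s₂)`, `(s₂,s₃)`, `(s₁,s₃)`. -/
def AncF (s t : P3) : ℤ :=
  (if s = (true, true, true) ∧ t = (false, false, false) then 1 else 0)
    - (if (s = (true, false, false) ∧ t = (false, true, false)) ∨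
          (s = (false, true, false) ∧ t = (false, false, true)) ∨
          (s = (true, false, false) ∧ t = (false, false, true)) then 1 else 0)

/-- The coordinates of the marks `(x, y; z)` read as `(z ~ x, z ~ y, x ~ y)`: the pattern with anchor `z`. -/
def permZ (s : P3) : P3 := (s.2.1, s.2.2, s.1)

/-- The sharing functional S1 with anchor `z` and exits `x, y`, in the coordinates `(x ~ y, x ~ z, y ~ z)`. -/
def S1zF (s t : P3) : ℤ := S1F (permZ s) (permZ t)

/-- The three-mark pattern of a four-mark pattern `(xy, xz, xq, yz, yq, zq)`. -/
def proj3 (s : P6) : P3 := (s.1, s.2.1, s.2.2.2.1)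

/-- The three-mark pattern after joining the blocks of `z` and `q`. -/
def zmerge3 (s : P6) : P3 :=
  (s.1 || (s.2.1 && s.2.2.2.2.1) || (s.2.2.1 && s.2.2.2.1), s.2.1 || s.2.2.1, s.2.2.2.1 || s.2.2.2.2.1)

/-- The certificate's up-set at the deletion: `x ~_R y ∨ x ~_R z ∨ x ~_R q`. -/
def Wa (s : P6) : Bool := s.1 || s.2.1 || s.2.2.1

/-- The certificate's up-set at the contraction: `x ~_R y ∨ x ~_R z`. -/
def Wd (s : P6) : Bool := s.1 || s.2.1

/-- **Key inequality (P)** on the fifteen partitions: on the red slice the conjecture's summand dominates the S1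
term on `W`. -/
theorem anc_key_P_valid : ∀ s ∈ valid6, ∀ t ∈ valid6,
    (if Wa s = true then S1zF (proj3 s) (proj3 t) else 0) ≤ AncF (zmerge3 s) (proj3 t) := by
  decide

/-- **Key inequality (VB)** on the fifteen partitions: on the blue slice the two summands dominate the S1 terms on
`W` and `W′`. -/
theorem anc_key_VB_valid : ∀ s ∈ valid6, ∀ t ∈ valid6,
    (if Wa s = true then S1zF (proj3 s) (proj3 t) else 0)
        + (if Wd s = true then S1zF (zmerge3 s) (zmerge3 t) else 0) ≤
      AncF (zmerge3 s) (proj3 t) + AncF (proj3 s) (zmerge3 t) := by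
  decide

/-- **Key inequality (P)** for transitive patterns. -/
theorem anc_key_P (s t : P6) (hs : Trans6 s) (ht : Trans6 t) :
    (if Wa s = true then S1zF (proj3 s) (proj3 t) else 0) ≤ AncF (zmerge3 s) (proj3 t) :=
  anc_key_P_valid s (trans6_mem s hs) t (trans6_mem t ht)

/-- **Key inequality (VB)** for transitive patterns. -/
theorem anc_key_VB (s t : P6) (hs : Trans6 s) (ht : Trans6 t) :
    (if Wa s = true then S1zF (proj3 s) (proj3 t) else 0)
        + (if Wd s = true then S1zF (zmerge3 s) (zmerge3 t) else 0) ≤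
      AncF (zmerge3 s) (proj3 t) + AncF (proj3 s) (zmerge3 t) :=
  anc_key_VB_valid s (trans6_mem s hs) t (trans6_mem t ht)

/-- When the connections of `z` agree in the two colours, every anchored class and `(⊤,⊥)` are empty. -/
theorem AncF_eq_zero_of_exit_eq : ∀ s t : P3, s.2.1 = t.2.1 → s.2.2 = t.2.2 → AncF s t = 0 := by
  decide

/-- The pointwise inequality of the split, with the slices. -/
theorem anc_ind_ineq (a b : Prop) [Decidable a] [Decidable b] (hba : b → a) (s t : P6) (hs : Trans6 s)
    (ht : Trans6 t) :
    ((if a ∧ Wa s = true then S1zF (proj3 s) (proj3 t) else 0)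
        + (if b ∧ Wd s = true then S1zF (zmerge3 s) (zmerge3 t) else 0) : ℤ) ≤
      (if a then AncF (zmerge3 s) (proj3 t) else 0) + (if b then AncF (proj3 s) (zmerge3 t) else 0) := by
  have kP := anc_key_P s t hs ht
  have kV := anc_key_VB s t hs ht
  by_cases ha : a <;> by_cases hb : b
  · simp only [ha, hb, true_and, ↓reduceIte]; exact kV
  · simp only [ha, hb, true_and, false_and, ↓reduceIte, add_zero]; exact kP
  · exact absurd (hba hb) ha
  · simp only [ha, hb, false_and, ↓reduceIte, add_zero, le_refl]

/-! ## The patterns of the contraction of an edge at the double-component of `z` -/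

variable [DecidableEq E₁]

/-- Red connectivity under the contraction, with the ends of `f` named by `Joins`. -/
theorem RdS_double_iff_joins (st : E₁ → EStat) (f : E₁) (ω : E₁ → Bool) {p q : V₁} (hj : Z₁.Joins f p q)
    (a b : V₁) :
    RdS Z₁ (Function.update st f .double) ω a b ↔
      RdS Z₁ (Function.update st f .absent) ω a b ∨
        (RdS Z₁ (Function.update st f .absent) ω a p ∧ RdS Z₁ (Function.update st f .absent) ω q b) ∨
        (RdS Z₁ (Function.update st f .absent) ω a q ∧ RdS Z₁ (Function.update st f .absent) ω p b) := by
  rw [RdS_double_iff_edge]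
  rcases hj with ⟨h1, h2⟩ | ⟨h1, h2⟩
  · rw [h1, h2]
  · rw [h1, h2]
    constructor
    · rintro (h | h | h)
      exacts [Or.inl h, Or.inr (Or.inr h), Or.inr (Or.inl h)]
    · rintro (h | h | h)
      exacts [Or.inl h, Or.inr (Or.inr h), Or.inr (Or.inl h)]

/-- Blue connectivity under the contraction, with the ends of `f` named by `Joins`. -/
theorem MgS_double_iff_joins (st : E₁ → EStat) (f : E₁) (ω : E₁ → Bool) {p q : V₁} (hj : Z₁.Joins f p q)
    (a b : V₁) :
    MgS Z₁ (Function.update st f .double) ω a b ↔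
      MgS Z₁ (Function.update st f .absent) ω a b ∨
        (MgS Z₁ (Function.update st f .absent) ω a p ∧ MgS Z₁ (Function.update st f .absent) ω q b) ∨
        (MgS Z₁ (Function.update st f .absent) ω a q ∧ MgS Z₁ (Function.update st f .absent) ω p b) := by
  rw [MgS_double_iff_edge]
  rcases hj with ⟨h1, h2⟩ | ⟨h1, h2⟩
  · rw [h1, h2]
  · rw [h1, h2]
    constructor
    · rintro (h | h | h)
      exacts [Or.inl h, Or.inr (Or.inr h), Or.inr (Or.inl h)]
    · rintro (h | h | h)
      exacts [Or.inl h, Or.inr (Or.inr h), Or.inr (Or.inl h)]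

/-- With `p` in the double-component of `z`, the contraction of `f = pq` joins the blocks of `z` and `q` (red). -/
theorem RdS_double_iff_zq {st : E₁ → EStat} {f : E₁} (hf : st f = .free) (ω : E₁ → Bool) {p q : V₁}
    (hj : Z₁.Joins f p q) (hp : p ∈ dblCompS Z₁ st u') (a b : V₁) :
    RdS Z₁ (Function.update st f .double) ω a b ↔
      RdS Z₁ (Function.update st f .absent) ω a b ∨
        (RdS Z₁ (Function.update st f .absent) ω a u' ∧ RdS Z₁ (Function.update st f .absent) ω q b) ∨
        (RdS Z₁ (Function.update st f .absent) ω a q ∧ RdS Z₁ (Function.update st f .absent) ω u' b) := by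
  rw [RdS_double_iff_joins Z₁ st f ω hj]
  have hzp : RdS Z₁ (Function.update st f .absent) ω u' p :=
    RdS_of_mem_dblComp Z₁ _ ω (dblComp_update_of_free Z₁ hf .absent hp)
  have hpz := RdS_symm_S1 Z₁ _ ω hzp
  have e1 : RdS Z₁ (Function.update st f .absent) ω a p ↔ RdS Z₁ (Function.update st f .absent) ω a u' :=
    ⟨fun h => reach_trans' h hpz, fun h => reach_trans' h hzp⟩
  have e2 : RdS Z₁ (Function.update st f .absent) ω p b ↔ RdS Z₁ (Function.update st f .absent) ω u' b :=
    ⟨fun h => reach_trans' hzp h, fun h => reach_trans' hpz h⟩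
  rw [e1, e2]

/-- With `p` in the double-component of `z`, the contraction of `f = pq` joins the blocks of `z` and `q` (blue). -/
theorem MgS_double_iff_zq {st : E₁ → EStat} {f : E₁} (hf : st f = .free) (ω : E₁ → Bool) {p q : V₁}
    (hj : Z₁.Joins f p q) (hp : p ∈ dblCompS Z₁ st u') (a b : V₁) :
    MgS Z₁ (Function.update st f .double) ω a b ↔
      MgS Z₁ (Function.update st f .absent) ω a b ∨
        (MgS Z₁ (Function.update st f .absent) ω a u' ∧ MgS Z₁ (Function.update st f .absent) ω q b) ∨
        (MgS Z₁ (Function.update st f .absent) ω a q ∧ MgS Z₁ (Function.update st f .absent) ω u' b) := by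
  rw [MgS_double_iff_joins Z₁ st f ω hj]
  have hzp : MgS Z₁ (Function.update st f .absent) ω u' p :=
    MgS_of_mem_dblComp Z₁ _ ω (dblComp_update_of_free Z₁ hf .absent hp)
  have hpz := MgS_symm_S1 Z₁ _ ω hzp
  have e1 : MgS Z₁ (Function.update st f .absent) ω a p ↔ MgS Z₁ (Function.update st f .absent) ω a u' :=
    ⟨fun h => reach_trans' h hpz, fun h => reach_trans' h hzp⟩
  have e2 : MgS Z₁ (Function.update st f .absent) ω p b ↔ MgS Z₁ (Function.update st f .absent) ω u' b :=
    ⟨fun h => reach_trans' hzp h, fun h => reach_trans' hpz h⟩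
  rw [e1, e2]

open Classical in
/-- The red pattern of the contraction is the z–q join of the four-mark pattern of the deletion. -/
theorem rsig_double_zmerge {st : E₁ → EStat} {f : E₁} (hf : st f = .free) (ω : E₁ → Bool) {p q : V₁}
    (hj : Z₁.Joins f p q) (hp : p ∈ dblCompS Z₁ st u') :
    rsig Z₁ u u' a₁ (Function.update st f .double) ω =
      zmerge3 (rsig6 Z₁ u u' q a₁ (Function.update st f .absent) ω) := by
  have h1 := RdS_double_iff_zq Z₁ u' hf ω hj hp a₁ u
  have h2 := RdS_double_iff_zq Z₁ u' hf ω hj hp a₁ u'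
  have h3 := RdS_double_iff_zq Z₁ u' hf ω hj hp u u'
  rw [RdS_comm Z₁ _ ω q u, RdS_comm Z₁ _ ω u' u] at h1
  rw [RdS_comm Z₁ _ ω q u'] at h2
  rw [RdS_comm Z₁ _ ω q u'] at h3
  have hr : RdS Z₁ (Function.update st f .absent) ω u' u' := RdS_refl' Z₁ _ ω u'
  simp only [rsig, rsig6, zmerge3, Prod.mk.injEq]
  refine ⟨?_, ?_, ?_⟩
  · by_cases hA : RdS Z₁ (Function.update st f .absent) ω a₁ u <;>
      by_cases hB : RdS Z₁ (Function.update st f .absent) ω a₁ u' <;>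
      by_cases hC : RdS Z₁ (Function.update st f .absent) ω u q <;>
      by_cases hD : RdS Z₁ (Function.update st f .absent) ω a₁ q <;>
      by_cases hE : RdS Z₁ (Function.update st f .absent) ω u u' <;> simp [h1, hA, hB, hC, hD, hE]
  · by_cases hB : RdS Z₁ (Function.update st f .absent) ω a₁ u' <;>
      by_cases hD : RdS Z₁ (Function.update st f .absent) ω a₁ q <;>
      by_cases hF : RdS Z₁ (Function.update st f .absent) ω u' q <;> simp [h2, hB, hD, hF, hr]
  · by_cases hC : RdS Z₁ (Function.update st f .absent) ω u q <;>
      by_cases hE : RdS Z₁ (Function.update st f .absent) ω u u' <;>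
      by_cases hF : RdS Z₁ (Function.update st f .absent) ω u' q <;> simp [h3, hC, hE, hF, hr]

open Classical in
/-- The blue pattern of the contraction is the z–q join of the four-mark pattern of the deletion. -/
theorem bsig_double_zmerge {st : E₁ → EStat} {f : E₁} (hf : st f = .free) (ω : E₁ → Bool) {p q : V₁}
    (hj : Z₁.Joins f p q) (hp : p ∈ dblCompS Z₁ st u') :
    bsig Z₁ u u' a₁ (Function.update st f .double) ω =
      zmerge3 (bsig6 Z₁ u u' q a₁ (Function.update st f .absent) ω) := by
  have h1 := MgS_double_iff_zq Z₁ u' hf ω hj hp a₁ u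
  have h2 := MgS_double_iff_zq Z₁ u' hf ω hj hp a₁ u'
  have h3 := MgS_double_iff_zq Z₁ u' hf ω hj hp u u'
  rw [MgS_comm Z₁ _ ω q u, MgS_comm Z₁ _ ω u' u] at h1
  rw [MgS_comm Z₁ _ ω q u'] at h2
  rw [MgS_comm Z₁ _ ω q u'] at h3
  have hr : MgS Z₁ (Function.update st f .absent) ω u' u' := MgS_refl' Z₁ _ ω u'
  simp only [bsig, bsig6, zmerge3, Prod.mk.injEq]
  refine ⟨?_, ?_, ?_⟩
  · by_cases hA : MgS Z₁ (Function.update st f .absent) ω a₁ u <;>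
      by_cases hB : MgS Z₁ (Function.update st f .absent) ω a₁ u' <;>
      by_cases hC : MgS Z₁ (Function.update st f .absent) ω u q <;>
      by_cases hD : MgS Z₁ (Function.update st f .absent) ω a₁ q <;>
      by_cases hE : MgS Z₁ (Function.update st f .absent) ω u u' <;> simp [h1, hA, hB, hC, hD, hE]
  · by_cases hB : MgS Z₁ (Function.update st f .absent) ω a₁ u' <;>
      by_cases hD : MgS Z₁ (Function.update st f .absent) ω a₁ q <;>
      by_cases hF : MgS Z₁ (Function.update st f .absent) ω u' q <;> simp [h2, hB, hD, hF, hr]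
  · by_cases hC : MgS Z₁ (Function.update st f .absent) ω u q <;>
      by_cases hE : MgS Z₁ (Function.update st f .absent) ω u u' <;>
      by_cases hF : MgS Z₁ (Function.update st f .absent) ω u' q <;> simp [h3, hC, hE, hF, hr]

omit [DecidableEq E₁] in
open Classical in
/-- The three-mark pattern is the projection of the four-mark one (red). -/
theorem rsig_eq_proj3 (st : E₁ → EStat) (ω : E₁ → Bool) (q : V₁) :
    rsig Z₁ u u' a₁ st ω = proj3 (rsig6 Z₁ u u' q a₁ st ω) := rfl

omit [DecidableEq E₁] in
open Classical in
/-- The three-mark pattern is the projection of the four-mark one (blue). -/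
theorem bsig_eq_proj3 (st : E₁ → EStat) (ω : E₁ → Bool) (q : V₁) :
    bsig Z₁ u u' a₁ st ω = proj3 (bsig6 Z₁ u u' q a₁ st ω) := rfl

omit [DecidableEq E₁] in
open Classical in
/-- The pattern with anchor `z` is the permuted pattern with anchor `x` (red). -/
theorem rsig_permZ (st : E₁ → EStat) (ω : E₁ → Bool) :
    rsig Z₁ a₁ u u' st ω = permZ (rsig Z₁ u u' a₁ st ω) := by
  simp only [rsig, permZ, Prod.mk.injEq, decide_eq_decide]
  exact ⟨RdS_comm Z₁ st ω u' a₁, RdS_comm Z₁ st ω u' u, trivial⟩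

omit [DecidableEq E₁] in
open Classical in
/-- The pattern with anchor `z` is the permuted pattern with anchor `x` (blue). -/
theorem bsig_permZ (st : E₁ → EStat) (ω : E₁ → Bool) :
    bsig Z₁ a₁ u u' st ω = permZ (bsig Z₁ u u' a₁ st ω) := by
  simp only [bsig, permZ, Prod.mk.injEq, decide_eq_decide]
  exact ⟨MgS_comm Z₁ st ω u' a₁, MgS_comm Z₁ st ω u' u, trivial⟩

omit [DecidableEq E₁] in
open Classical in
/-- The certificate's up-set `W` at a colouring. -/
theorem wa_iff (st : E₁ → EStat) (ω : E₁ → Bool) (q : V₁) :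
    Wa (rsig6 Z₁ u u' q a₁ st ω) = true ↔ RdS Z₁ st ω a₁ u ∨ RdS Z₁ st ω a₁ u' ∨ RdS Z₁ st ω a₁ q := by
  simp [Wa, rsig6, or_assoc]

omit [DecidableEq E₁] in
open Classical in
/-- The certificate's up-set `W′` at a colouring. -/
theorem wd_iff (st : E₁ → EStat) (ω : E₁ → Bool) (q : V₁) :
    Wd (rsig6 Z₁ u u' q a₁ st ω) = true ↔ RdS Z₁ st ω a₁ u ∨ RdS Z₁ st ω a₁ u' := by
  simp [Wd, rsig6]

end MultiExit

end ZoneZ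

end PercRepro
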